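import Summits.HodgeConjecture.HodgeConjecture.Theorems.GenericDivisibilityGenericDivisibilityBoundedFunctionFieldForms
import HarnessLib

/-!
# Route GenericDivisibility — crux C2 `GenericDivisibilityBounded` (stmt-HodgeConjecture-18467),
# line `finite-level-bootstrap`: the HEART's hypothesis `D'(m, z)` and conclusion at the generic point

Sorry-free, definition-free record of the two registered sub-goals
`stub_levelDivisibleIffFunctionField` and `stub_levelCleanIffFunctionField` of the line
`finite-level-bootstrap` on the crux C2 of route `GenericDivisibility` (sequel of `…FunctionField`,
p160865, the exact-divisibility case, and of `…FunctionFieldForms`, p162355, `GT = ρ⁻¹(torsion)`).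

For `X` irreducible over `ℂ` with generic point `η`, `ρ := Motives.toFunctionField ℤ X k :
H^k(X(ℂ); ℤ) → H^k(ℂ(X); ℤ) = colim_{U ∋ η} H^k(U(ℂ); ℤ)` (`Motives.functionFieldCohomology`, the stalk at
`η` of the Zariski presheaf `U ↦ H^k(U(ℂ); ℤ)`; Bloch–Ogus 1974, (3.9); Colliot-Thélène–Voisin 2012,
§2.1), `z ∈ H^k(X(ℂ); ℤ)` and `m : ℕ`:

* `stub_levelDivisibleIffFunctionField` — **`D'(m, z)` at the generic point**: "on some non-empty
  Zariski open `X ∖ Z`, `M • (z| - m • y) = 0` for some class `y` there and some `M ≥ 1`" iff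
  "`M • (ρ z - m • f) = 0` for some `f ∈ H^k(ℂ(X); ℤ)` and some `M ≥ 1`". `→`: take germs at `η ∈ X ∖ Z`
  (the germ map is additive). `←`: `f` is the germ of a section `y_U` over some open `U ∋ η`; the
  section `M • (z|_U - m • y_U)` has germ `0`, so it vanishes on a smaller open `W ∋ η`, whose closed
  complement is proper.
* `stub_levelCleanIffFunctionField` — **the HEART of the line at `(ℓ, s, X)` in degree `k`, entirely
  at the generic point**: "every `z` with `D'(ℓ^s, z)` admits `w` with `z - ℓ • w` generically torsion"
  iff "every `z` with `M • (ρ z - ℓ^s • f) = 0` for some `f`, `M ≥ 1` admits `w` and `N ≥ 1` with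
  `ρ (N • (z - ℓ • w)) = 0`" — pure rewriting by the first result (at `m := ℓ^s`) and
  `genericDivisibilityBounded_GT_iff_exists_toFunctionField_nsmul_eq_zero` (at `z - ℓ • w`).

References: [BlochOgus1974ENS] (3.8)–(3.9); [ColliotTheleneVoisin2012] §2.1, Thm. 2.8 (ii).
-/

set_option linter.dupNamespace false

noncomputable section

namespace Summit.HodgeConjecture.HodgeConjecture.Theorems

open CategoryTheory AlgebraicGeometry Opposite TopologicalSpace
open Literature.AlgebraicGeometry.Motives Literature.AlgebraicGeometry.HodgeTheory
  Literature.AlgebraicTopology.SingularHomology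

/-- Restriction `H^k(X(ℂ);ℤ) → H^k((X∖Z)(ℂ);ℤ)`, the very term of the route decls (notation only). -/
local notation3 (prettyPrint := false) "Res[" X ", " Z ", " k "]" =>
  singularCohomology.map ℤ ℤ
    (⟨Subtype.val, continuous_subtype_val⟩ : C(complexPointsCompl X Z, ComplexPoints X)) k

/-! ### `D'(m, z)` at the generic point -/

/-- **Registered sub-goal `stub_levelDivisibleIffFunctionField` of stmt-HodgeConjecture-18467 (line
`finite-level-bootstrap`): divisibility by `m` up to torsion on a non-empty Zariski open is
divisibility by `m` up to torsion at the generic point.** For `X` irreducible over `ℂ`,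
`z ∈ H^k(X(ℂ); ℤ)` and `m : ℕ`: there are a Zariski-closed `Z ≠ X`, a class `y ∈ H^k((X ∖ Z)(ℂ); ℤ)` and
`M ≥ 1` with `M • (z|_{(X ∖ Z)(ℂ)} - m • y) = 0` iff there are `f ∈ H^k(ℂ(X); ℤ) = colim_{U ∋ η} H^k(U(ℂ); ℤ)`
(Bloch–Ogus 1974, (3.9), at the generic point; Colliot-Thélène–Voisin 2012, §2.1) and `M ≥ 1` with
`M • (z_η - m • f) = 0`. `→`: the open `X ∖ Z` is non-empty, hence contains `η`, and the germ map is
additive. `←`: every element of the stalk is a germ of a section `y_U` over some open `U ∋ η`; the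
section `M • (z|_U - m • y_U)` and `0` have the same germ, so they agree on some open `W ∋ η`, `W ≤ U`,
and `Z := X ∖ W` is closed and proper. [cite: BlochOgus1974ENS, (3.9)]
[cite: ColliotTheleneVoisin2012, §2.1 and Thm. 2.8 (ii)] -/
theorem stub_levelDivisibleIffFunctionField : ∀ ⦃X : SchemeOver ℂ⦄ [IrreducibleSpace X.left] (k : ℕ) (z : singularCohomology ℤ ℤ (ComplexPoints X) k) (m : ℕ), (∃ Z : Set X.left, IsClosed Z ∧ Z ≠ Set.univ ∧ ∃ (y : singularCohomology ℤ ℤ (complexPointsCompl X Z) k) (M : ℕ), 1 ≤ M ∧ M • (singularCohomology.map ℤ ℤ (⟨Subtype.val, continuous_subtype_val⟩ : C(complexPointsCompl X Z, ComplexPoints X)) k z - m • y) = 0) ↔ ∃ (f : functionFieldCohomology ℤ X k) (M : ℕ), 1 ≤ M ∧ M • (toFunctionField ℤ X k z - m • f) = 0 := by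
  intro X _ k z m
  constructor
  · rintro ⟨Z, hZ, hne, y, M, hM, hy⟩
    -- the non-empty open `U := X ∖ Z` contains the generic point
    let U : X.left.Opens := ⟨Zᶜ, hZ.isOpen_compl⟩
    have hU : genericPoint X.left ∈ U :=
      genericPoint_mem_of_nonempty (U := U) (Set.nonempty_compl.2 hne)
    -- transport `y` from `(X ∖ Z)(ℂ)` to `U(ℂ) = (X ∖ Zᶜᶜ)(ℂ)` along `Z ⊆ Zᶜᶜ`
    have hsub : Z ⊆ ((U : Set X.left))ᶜ := fun x hx hx' ↦ hx' hx
    have hres : singularCohomology.map ℤ ℤ (complexPointsComplInclusion hsub) k (Res[X, Z, k] z) =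
        restrictToOpen ℤ X k U z := by
      rw [← ModuleCat.comp_apply, ← singularCohomology.map_comp]
      rfl
    -- `M • (z|_U - m • y|_U) = 0` on `U(ℂ)`
    have h1 := congrArg (singularCohomology.map ℤ ℤ (complexPointsComplInclusion hsub) k) hy
    rw [map_nsmul, map_sub, map_nsmul, map_zero, hres] at h1
    refine ⟨germToFunctionField ℤ X k U hU
      (singularCohomology.map ℤ ℤ (complexPointsComplInclusion hsub) k y), M, hM, ?_⟩
    -- take germs at `η`
    have h2 := congrArg (germToFunctionField ℤ X k U hU) h1
    rw [map_nsmul, map_sub, map_nsmul, map_zero, germToFunctionField_restrictToOpen] at h2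
    exact h2
  · rintro ⟨f, M, hM, hf⟩
    -- `f` is the germ of a section `yU` over some open `U ∋ η`
    obtain ⟨U, hU, yU, rfl⟩ := (bettiZariskiTopPresheaf ℤ X k).exists_germ_eq f
    have h' : germToFunctionField ℤ X k U hU (M • (restrictToOpen ℤ X k U z - m • yU)) =
        germToFunctionField ℤ X k U hU 0 := by
      rw [map_nsmul, map_sub, map_nsmul, map_zero, germToFunctionField_restrictToOpen]
      exact hf
    -- equal germs agree on a smaller open `W ∋ η`
    obtain ⟨W, hW, iU, iV, e⟩ :=
      TopCat.Presheaf.germ_eq (bettiZariskiTopPresheaf ℤ X k) (U := U) (V := U) (genericPoint X.left)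
        hU hU _ _ h'
    refine ⟨(W : Set X.left)ᶜ, W.isOpen.isClosed_compl, ?_,
      (bettiZariskiPresheaf ℤ X k).map iU.op yU, M, hM, ?_⟩
    · intro h
      have hη : genericPoint X.left ∈ (W : Set X.left)ᶜ := h ▸ Set.mem_univ _
      exact hη hW
    · have e' : (bettiZariskiPresheaf ℤ X k).map iU.op (M • (restrictToOpen ℤ X k U z - m • yU)) =
          (bettiZariskiPresheaf ℤ X k).map iV.op 0 := e
      rw [map_nsmul, map_sub, map_nsmul, map_zero, map_restrictToOpen_apply] at e'
      exact e'

/-! ### The heart of the line at the generic point -/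

/-- **Registered sub-goal `stub_levelCleanIffFunctionField` of stmt-HodgeConjecture-18467 (line
`finite-level-bootstrap`): the HEART at `(ℓ, s, X)` in degree `k`, entirely at the generic point.**
On an irreducible `X`, "every integral class `z` divisible by `ℓ^s` up to torsion on a non-empty
Zariski open admits `w` with `z - ℓ • w` generically torsion (`∃ Z` closed `≠ X`, `N ≥ 1`,
`N • (z - ℓ • w)|_{(X ∖ Z)(ℂ)} = 0`)" iff "every `z` with `M • (z_η - ℓ^s • f) = 0` in `H^k(ℂ(X); ℤ)` for
some `f` and `M ≥ 1` admits `w` and `N ≥ 1` with `(N • (z - ℓ • w))_η = 0`": the hypotheses agree by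
`stub_levelDivisibleIffFunctionField` at `m := ℓ^s` (Bloch–Ogus (3.9): `H^k(ℂ(X); ℤ)` is the colimit
over the non-empty opens), the conclusions by `GT = ρ⁻¹(torsion)`
(`genericDivisibilityBounded_GT_iff_exists_toFunctionField_nsmul_eq_zero`, Bloch–Ogus (3.8):
`ker ρ = N¹_ℤ H^k`). [cite: BlochOgus1974ENS, (3.8)–(3.9)]
[cite: ColliotTheleneVoisin2012, §2.1 and Thm. 2.8 (ii)] -/
theorem stub_levelCleanIffFunctionField : ∀ ⦃X : SchemeOver ℂ⦄ [IrreducibleSpace X.left] (k ℓ s : ℕ), (∀ z : singularCohomology ℤ ℤ (ComplexPoints X) k, (∃ Z : Set X.left, IsClosed Z ∧ Z ≠ Set.univ ∧ ∃ (y : singularCohomology ℤ ℤ (complexPointsCompl X Z) k) (M : ℕ), 1 ≤ M ∧ M • (singularCohomology.map ℤ ℤ (⟨Subtype.val, continuous_subtype_val⟩ : C(complexPointsCompl X Z, ComplexPoints X)) k z - ℓ ^ s • y) = 0) → ∃ w : singularCohomology ℤ ℤ (ComplexPoints X) k, ∃ Z : Set X.left, IsClosed Z ∧ Z ≠ Set.univ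 ∧ ∃ N : ℕ, 1 ≤ N ∧ N • singularCohomology.map ℤ ℤ (⟨Subtype.val, continuous_subtype_val⟩ : C(complexPointsCompl X Z, ComplexPoints X)) k (z - ℓ • w) = 0) ↔ (∀ z : singularCohomology ℤ ℤ (ComplexPoints X) k, (∃ (f : functionFieldCohomology ℤ X k) (M : ℕ), 1 ≤ M ∧ M • (toFunctionField ℤ X k z - ℓ ^ s • f) = 0) → ∃ (w : singularCohomology ℤ ℤ (ComplexPoints X) k) (N : ℕ), 1 ≤ N ∧ toFunctionField ℤ X k (N • (z - ℓ • w)) = 0) :=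
  fun _ _ k ℓ s ↦ forall_congr' fun z ↦
    imp_congr (stub_levelDivisibleIffFunctionField k z (ℓ ^ s))
      (exists_congr fun w ↦
        genericDivisibilityBounded_GT_iff_exists_toFunctionField_nsmul_eq_zero (z - ℓ • w))

end Summit.HodgeConjecture.HodgeConjecture.Theorems

end
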